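import Literature.NumberTheory.Automorphic.CuspidalCohomologyGL
import Literature.NumberTheory.DiophantineGeometry.WeylModuleIntegralForm
import HarnessLib

/-!
# The integral form `M_λ ⊆ V_λ(k)` of the coefficient module of `GL_n` over a subring `𝒪 ⊆ k`

Topic `NumberTheory/Automorphic`; namespace `Literature.NumberTheory.Automorphic.GLnCohomology`
(that of the coefficient modules `V_λ(k) = GLnCohomology.CoeffModule k n λ` and representations
`coeffRepGL k n λ = S_{λ−λ_{n−1}} ⊗ det^{λ_{n−1}}` of `CuspidalCohomologyGL`).  One definition with a
body and theorems; no named fact, no instance, no `sorry`.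

`V_λ(k)` is the Weyl module `S_μ(kⁿ)`, `μ = λ − λ_{n−1}`, twisted by `det^{λ_{n−1}}`.  Its
**integral form** `coeffIntForm k 𝒪 n λ = c_μ · (𝒪ⁿ)^{⊗d}` (the `weylIntForm` of
`WeylModuleIntegralForm`) is an `𝒪`-submodule which

* spans `V_λ(k)` over `k` and is finitely generated over `𝒪` (`span_coeffIntForm_eq_top`,
  `coeffIntForm_fg`);
* is **stable under `GL_n(𝒪)`** acting through `coeffRepGL` (`coeffRepGL_mem_coeffIntForm`: the
  Weyl module part by `weylRep_mem_weylIntForm`, the twist `det(g)^{λ_{n−1}} ∈ 𝒪ˣ`);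
* carries the **congruences** `g x - x ∈ I • coeffIntForm` for `g ∈ GL_n(𝒪)`, `g ≡ 1 (mod I)`
  (`coeffRepGL_sub_mem_smul_coeffIntForm`; for the twist, `det(g)^m ≡ 1 (mod I)`,
  `units_zpow_sub_one_mem`).

This is the finite free `ℤ̄_p`-module `M_ξ` with `M_ξ[p⁻¹] = ξ` of [Scholze2015, §V.4, before
Thm. V.4.1] for the algebraic representation `ξ = V_λ` of `GL_n`, on which a level small enough at `p`
acts trivially modulo `p^m` (loc. cit., proof of Thm. V.4.1), and the `𝒪[GL_n(𝒪_{F,p})]`-module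
`M_λ` of [KhareThorne2017, §6.4].

## References

* P. Scholze, *On torsion in the cohomology of locally symmetric varieties*, Ann. of Math. 182
  (2015), §V.4 (arXiv:1306.2070, p. 66). [Scholze2015]
* C. Khare, J. A. Thorne, Amer. J. Math. 139 (2017), §6.4. [KhareThorne2017]
* W. Fulton, J. Harris, *Representation Theory*, GTM 129, §15.5. [FultonHarrisGTM129]
-/

noncomputable section

open Literature.NumberTheory.DiophantineGeometry

namespace Literature.NumberTheory.Automorphic.GLnCohomology

variable (k : Type) [Field k] (𝒪 : Subring k) (n : ℕ) (wt : Fin n → ℤ)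

/-- **The integral form `M_λ = c_μ · (𝒪ⁿ)^{⊗d} ⊆ V_λ(k)`** of the coefficient module over the
subring `𝒪 ⊆ k` (the `weylIntForm` of the Weyl module `S_μ(kⁿ)`, `μ = λ − λ_{n−1}`, that `V_λ(k)`
is). [cite: Scholze2015, §V.4 (M_ξ, before Thm. V.4.1)] [cite: KhareThorne2017, §6.4 (M_λ)] -/
def coeffIntForm : Submodule 𝒪 (CoeffModule k n wt) :=
  show Submodule 𝒪 ↥(weylModule k (Fin n) (coeffPartition wt)) from
    weylIntForm k 𝒪 (Fin n) (coeffPartition wt)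

/-- **`M_λ` spans `V_λ(k)` over `k`** (`M_ξ[p⁻¹] = ξ`). [cite: Scholze2015, §V.4] -/
theorem span_coeffIntForm_eq_top :
    Submodule.span k (coeffIntForm k 𝒪 n wt : Set (CoeffModule k n wt)) = ⊤ :=
  span_weylIntForm_eq_top k 𝒪 (Fin n) (coeffPartition wt)

/-- **`M_λ` is finitely generated over `𝒪`.** [folklore] -/
theorem coeffIntForm_fg : (coeffIntForm k 𝒪 n wt).FG :=
  weylIntForm_fg k 𝒪 (Fin n) (coeffPartition wt)

/-- The Weyl part of `coeffRepGL` preserves `M_λ` (`weylRep_mem_weylIntForm`). [folklore] -/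
theorem weylRepCoeff_mem_coeffIntForm (g : GL (Fin n) 𝒪) {x : CoeffModule k n wt}
    (hx : x ∈ coeffIntForm k 𝒪 n wt) :
    weylRepCoeff k n wt (Matrix.GeneralLinearGroup.map 𝒪.subtype g) x ∈ coeffIntForm k 𝒪 n wt :=
  weylRep_mem_weylIntForm k 𝒪 (Fin n) (coeffPartition wt) g hx

/-- The Weyl part of `coeffRepGL` satisfies the congruences (`weylRep_sub_mem_smul_weylIntForm`).
[folklore] -/
theorem weylRepCoeff_sub_mem_smul_coeffIntForm (I : Ideal 𝒪) (g : GL (Fin n) 𝒪)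
    (hg : ∀ r c, (g : Matrix (Fin n) (Fin n) 𝒪) r c - (1 : Matrix (Fin n) (Fin n) 𝒪) r c ∈ I)
    {x : CoeffModule k n wt} (hx : x ∈ coeffIntForm k 𝒪 n wt) :
    weylRepCoeff k n wt (Matrix.GeneralLinearGroup.map 𝒪.subtype g) x - x ∈
      I • coeffIntForm k 𝒪 n wt :=
  weylRep_sub_mem_smul_weylIntForm k 𝒪 (Fin n) (coeffPartition wt) I g hg hx

/-- The twisting scalar `det(g)^m` of an `𝒪`-point is the image of the unit `det(g)^m ∈ 𝒪ˣ`.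
[folklore] -/
theorem coe_det_map_zpow (g : GL (Fin n) 𝒪) (m : ℤ) :
    ((Matrix.GeneralLinearGroup.det (Matrix.GeneralLinearGroup.map 𝒪.subtype g) ^ m : kˣ) : k) =
      (((Matrix.GeneralLinearGroup.det g ^ m : 𝒪ˣ) : 𝒪) : k) := by
  rw [Matrix.GeneralLinearGroup.map_det, ← map_zpow, Units.coe_map]
  rfl

/-- **`det(g)^m ≡ 1 (mod I)`** for `g ≡ 1 (mod I)` in `GL_n(𝒪)` and `m ∈ ℤ`: reduce modulo `I`,
where `g ↦ 1` and units map to units. [folklore] -/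
theorem units_zpow_sub_one_mem (I : Ideal 𝒪) (g : GL (Fin n) 𝒪)
    (hg : ∀ r c, (g : Matrix (Fin n) (Fin n) 𝒪) r c - (1 : Matrix (Fin n) (Fin n) 𝒪) r c ∈ I)
    (m : ℤ) : ((Matrix.GeneralLinearGroup.det g ^ m : 𝒪ˣ) : 𝒪) - 1 ∈ I := by
  rw [← Ideal.Quotient.eq, map_one]
  -- `g ≡ 1 (mod I)` as matrices over `𝒪 ⧸ I`
  have h1 : Matrix.GeneralLinearGroup.map (Ideal.Quotient.mk I) g = 1 := by
    refine Matrix.GeneralLinearGroup.ext fun r c => ?_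
    have h : (1 : Matrix (Fin n) (Fin n) (𝒪 ⧸ I)) r c =
        Ideal.Quotient.mk I ((1 : Matrix (Fin n) (Fin n) 𝒪) r c) := by
      rw [Matrix.one_apply, Matrix.one_apply]
      split_ifs <;> simp
    rw [Matrix.GeneralLinearGroup.map_apply, Units.val_one, h, Ideal.Quotient.eq]
    exact hg r c
  have h2 : Units.map (Ideal.Quotient.mk I : 𝒪 →* 𝒪 ⧸ I) (Matrix.GeneralLinearGroup.det g) = 1 := by
    rw [← Matrix.GeneralLinearGroup.map_det, h1, map_one]
  have h3 : Units.map (Ideal.Quotient.mk I : 𝒪 →* 𝒪 ⧸ I) (Matrix.GeneralLinearGroup.det g ^ m) = 1 := by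
    rw [map_zpow, h2, one_zpow]
  have h4 := congrArg Units.val h3
  rw [Units.coe_map, Units.val_one] at h4
  exact h4

/-- **`M_λ` is stable under `GL_n(𝒪)`** acting through `coeffRepGL = det^{λ_{n−1}} ⊗ S_μ`.
[cite: KhareThorne2017, §6.4 (M_λ is an 𝒪[GL_n(𝒪_{F,p})]-module)] -/
theorem coeffRepGL_mem_coeffIntForm (g : GL (Fin n) 𝒪) {x : CoeffModule k n wt}
    (hx : x ∈ coeffIntForm k 𝒪 n wt) :
    coeffRepGL k n wt (Matrix.GeneralLinearGroup.map 𝒪.subtype g) x ∈ coeffIntForm k 𝒪 n wt := by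
  rw [coeffRepGL_apply, coe_det_map_zpow]
  exact Submodule.smul_mem _ (Matrix.GeneralLinearGroup.det g ^ lowestEntry wt : 𝒪ˣ).val
    (weylRepCoeff_mem_coeffIntForm k 𝒪 n wt g hx)

/-- **Congruences on `M_λ`**: for `g ∈ GL_n(𝒪)` with `g ≡ 1 (mod I)`,
`V_λ(g) x - x ∈ I • M_λ` for every `x ∈ M_λ` — a level small enough at `p` acts trivially on
`M_ξ / p^m`. [cite: Scholze2015, §V.4 (proof of Thm. V.4.1)] -/
theorem coeffRepGL_sub_mem_smul_coeffIntForm (I : Ideal 𝒪) (g : GL (Fin n) 𝒪)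
    (hg : ∀ r c, (g : Matrix (Fin n) (Fin n) 𝒪) r c - (1 : Matrix (Fin n) (Fin n) 𝒪) r c ∈ I)
    {x : CoeffModule k n wt} (hx : x ∈ coeffIntForm k 𝒪 n wt) :
    coeffRepGL k n wt (Matrix.GeneralLinearGroup.map 𝒪.subtype g) x - x ∈
      I • coeffIntForm k 𝒪 n wt := by
  rw [coeffRepGL_apply, coe_det_map_zpow]
  set c : 𝒪 := ((Matrix.GeneralLinearGroup.det g ^ lowestEntry wt : 𝒪ˣ) : 𝒪) with hc
  set w := weylRepCoeff k n wt (Matrix.GeneralLinearGroup.map 𝒪.subtype g) x with hw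
  -- `c • w - x = c • (w - x) + (c - 1) • x`
  have h : (c : k) • w - x = c • (w - x) + (c - 1) • x := by
    rw [show (c • (w - x) : CoeffModule k n wt) = (c : k) • (w - x) from rfl,
      show ((c - 1) • x : CoeffModule k n wt) = ((c - 1 : 𝒪) : k) • x from rfl]
    push_cast
    rw [smul_sub, sub_smul, one_smul]
    abel
  rw [h]
  exact Submodule.add_mem _
    (Submodule.smul_mem _ c (weylRepCoeff_sub_mem_smul_coeffIntForm k 𝒪 n wt I g hg hx))
    (Submodule.smul_mem_smul (units_zpow_sub_one_mem k 𝒪 n I g hg _) hx)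

end Literature.NumberTheory.Automorphic.GLnCohomology
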